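import Summits.QuantumFields.YangMills.Theorems.UnitScaleTiltProp8FlatHCurlCurl
import Literature.MathematicalPhysics.QuantumFieldTheory.Balaban1983to89.T4Continuum
import Mathlib.Analysis.InnerProductSpace.Calculus
import Mathlib.Analysis.Calculus.Gradient.Basic
import HarnessLib

/-!
# K0⁷ STUB 1 (`stub_prop8StepCoP13` = [15] Prop. 8 top step ⟺ Sect. F one pass), sub-target S4b «the (δ∕δA′)V pieces at objects», brick 6:
# **THE `H`-TERMS OF SECT. F's `V` ((157): `−⟨A′, ∂*∂HD(A′)⟩ + ½⟨HD(A′), ∂*∂HD(A′)⟩`) IN PRINT's (87)–(88) MULTIPLIER FORM AT THE RECORD's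
# FLAT OPERATORS** — `½‖∂(A′ − HX)‖² = ½‖∂A′‖² + ½⟨X, MX⟩ − ⟨QA′, MX⟩` with `M = (QGQ*)⁻¹ − a` for EVERY nested family, the gradient of this
# block form WITHOUT any `∂*∂` in it ((88): `𝔇*(A′)M(D(A′) − QA′) − Q*M D(A′)`), and its pointwise (98)-slot from the three printed letters
# [5] (3.132) ∕ (55) ∕ (73) — the form in which Prop. 4's constant for the `H`-groups is lattice-uniform

Cell `pub-ymgap`, width seat `pub-ymgap-k0-s1-w2` g2 (director-ym №197 ∕ HUMAN RULING D-0149; plan g77–g80 W-SEAT-START-LIST §k0-s1, w2 ↦ S4b; successor of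
g0's five V₀-group files p584681 · p586870 · p587784 · p589096 · p590049).  `--kind proof --supports stmt-QuantumFields-20541 --as helper`; count-neutral.
[15] = [Balaban1985Variational] = T. Bałaban, *The variational problem and background fields in renormalization group method for lattice gauge theories*,
Commun. Math. Phys. **102** (1985) 277–309; [B6] = [Balaban1984PropagatorsII], CMP **96** (1984) 223–250; [5] = [Balaban1985BackgroundPropagators].

WHY.  In Sect. F's chart `A = A′ − HD(A′)` (p. 302 «It is much simpler now») the functional is `𝔊(A′) = ½⟨A′ − HD(A′), ∂*∂(A′ − HD(A′))⟩ +
V₀(A′ − HD(A′))` (157), so `W = (δ∕δA′)V` of (158) is the sum of the V₀-group (g0's files: its (98)-slot with a lattice-UNIFORM constant at the flat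
background) and the gradient of the two `H`-terms `−⟨A′, ∂*∂HD(A′)⟩ + ½⟨HD(A′), ∂*∂HD(A′)⟩` ((80) at `J = 0`, `Δ_π = ∂*∂`).  lit-balaban's object
`B11Eq80Current.W80` carries these as `W₂ = −(Δ_π(HD A′) + (H𝔇(A′))ᵀ(Δ_πA′))`, `W₃`, and its typed (98)-slot (`B11Eq98CurrentSlot.norm_W2_le`,
`C4W`, `B11Ineq73KernelLettersUniform.exists_quadAnalytic_W80_uniform`, letter `M_Δ`) runs through the OPERATOR NORM `‖Δ_π‖ : (115) → (−3)`.  At the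
record's flat `∂*∂` that norm is of order `(d−1)·L^j` on level-`j` bonds (the (115) size controls only `|∇_ηA′|(L^jη)²`, and a lattice-scale oscillation
has `|∂*∂A′|(L^jη)³ ≈ 2(d−1)L^j·|∇_ηA′|(L^jη)²`), i.e. of order `(d−1)η⁻¹` at the top level: NOT lattice-uniform — while (165)–(166) p. 304 need print's «C₄ depends on d and L only» (p. 293; `a₅` absolute).
Print never meets `‖Δ_πA′‖`: p. 291 (87) *«⟨A′, Δ_πHD(A′)⟩ = ⟨A′, (Δ_π + DRD*)HD(A′)⟩ = … = ⟨A′, Q*(QGQ*)⁻¹(L^{j(·)}η)⁻¹D(A′)⟩ − ⟨A′, Q*a(L^{j(·)}η)⁻¹D(A′)⟩»*,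
whence (88) *«Q*(QGQ*)⁻¹(·)D(A′) − Q*a(·)D(A′) + 𝔇*(A′)(·)(QGQ*)⁻¹QA′ − 𝔇*(A′)(·)aQA′»* — no derivative of `A′` — and *«Applying the inequalities
(3.132) from [5], (55), (73) … we can estimate this functional derivative by O(1)ε₃²(Lʲη)⁻³»* (lit-balaban `B11Eq88Estimate`: that bookkeeping over
abstract kernels).  The identity behind (87) is (137) p. 298, which the route `UnitScaleTilt` PROVED EXACTLY at the flat multi-level operators of every
nested family (`FlatHCurlCurl.curlCurl_hOp`: `∂*∂(HB) = Q*((QGQ*)⁻¹B) − Q*(aB)`, from `FlatCubeOperators.deltaAE_hOp`, `RE_dsE_hOp`, `QE_hOp`).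
THIS FILE types the substitution (87) → (88) AT THOSE OBJECTS and in the currency of k0-s1-w1's (128) ⟹ (158) chain
(`K0Stub1Eq158FlatOpsAtRecord.eq158_of_critical128_flatOps`: `⟪δ, Δ_aA′ + W A′⟫ = 0` on `ker Q`, `W A′ ∈ BondSpace P`): the `H`-part of (157) IS a
block-level quadratic-linear form in `(D(A′), QA′)`, its gradient is a vector of `BondSpace P` built from `Q*`, `𝔇(A′)*` and `M` only, and its (98)-slot
reads the three printed letters and nothing of `∂*∂`.

WHAT IS PROVED (sorry-free; no definition; axioms standard).  `P : Params`, `D : B6SectADomainsV1.Domains P` ANY nested family (the cube sequence (144),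
the one-level family, …), lattice factor `c ≠ 0`, weights `w > 0`, `H := hOp (GE D) (QsE D) (EE D)` (print's `H`, (45)∕(157)), `M := EE D − aE D w`
(print's `(QGQ*)⁻¹ − a`, self-adjoint).
* §1 `inner_dcE_hOp_eq_multiplier` (`⟪∂Y, ∂(HX)⟫ = ⟪QY, (QGQ*)⁻¹X⟫ − ⟪QY, aX⟫` — (87) for every `Y`, not only Landau-gauge ones, since `R∂*H = 0`),
  `inner_deltaAE_hOp_eq_multiplier` (the `Δ_a`-reading `⟪Y, Δ_a(HX)⟫ = ⟪QY, (QGQ*)⁻¹X⟫`), ★ `normSq_dcE_chart_expand` — THE `H`-PART OF (157), EXACTLY: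
  `½‖∂(A′ − HX)‖² = ½‖∂A′‖² + ½(⟪X, (QGQ*)⁻¹X⟫ − ⟪X, aX⟫) − (⟪QA′, (QGQ*)⁻¹X⟫ − ⟪QA′, aX⟫)` for EVERY block datum `X` (at `X = D(A′)` of (49) this is
  `−⟨A′, ∂*∂HD⟩ + ½⟨HD, ∂*∂HD⟩` of (80)∕(157)), and `inner_deltaAE_chart_expand` (the same with `Δ_a` and `M = (QGQ*)⁻¹`).
* §2 (abstract carriers: ANY real inner-product spaces for the calculus, ANY `ℓ²`-products `PiLp 2` for the slot — the scalar model's `EuclideanSpace ℝ ι` and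
  S1's `TangentBondSU = PiLp 2 (fun _ => 𝔰𝔲(N))` alike): for continuous linear `Q`, a self-adjoint `M`, a map `D` Fréchet-differentiable at `A′` with derivative `𝔇`: ★ `hasFDerivAt_multiplierForm` ((88): the derivative of
  `A ↦ ½⟪D A, M D A⟫ − ⟪QA, M D A⟫` at `A′` is `δ ↦ ⟪M(DA′ − QA′), 𝔇δ⟫ − ⟪M DA′, Qδ⟫`), ★ `hasGradientAt_multiplierForm` (its Riesz vector
  `W_H(A′) = 𝔇†M(DA′ − QA′) − Q†M DA′`), ★ `gradMultiplierForm_slot98` (UST-pointwise: from the DISPLAYED letters — (3.132) `O₁` for `M` between block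
  weights `wB → wB′`, `q₀` for `Q†` and (73)ᵀ `θ` for `𝔇†` from `wB′` to the fine weight `w₃`, (55) `C_D r²` for `DA′`, the averaging bound `q r` for `QA′` —
  `w₃(b)|W_H(A′)(b)| ≤ θ·O₁·(C_D r² + q r) + q₀·O₁·C_D r²`, i.e. `≤ C₄r²` with `C₄ = θ₀O₁(C_D a₃ + q) + q₀O₁C_D` once `θ = θ₀r`, `r ≤ a₃`).
* §3 at the flat operators of the family: ★★ `hasGradientAt_hPart157` — the gradient of `A ↦ ½‖∂(A − H D(A))‖² − ½‖∂A‖²` at `A′` IS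
  `𝔇†M(DA′ − QA′) − Q†M DA′` with `Q = QE D`, `M = EE D − aE D w` read as continuous linear maps (displayed by their defining equations), for ANY
  `D` differentiable at `A′`; `hPart157_slot98` (§2's slot read there).
* §4 `inner_deltaAE_eq_inner_dcE_of_ker_of_landau` — the junction one-liner for k0-s1-w1's (128): `Qδ = 0 ∧ R∂*A′ = 0 ⇒ ⟪δ, Δ_aA′⟫ = ⟪∂δ, ∂A′⟫`
  (on the tangent space (83)∕(100) and in the gauge (153) the quadratic forms of `Δ_a` and of (157) have the same first variation).
* §5 `hasGradientAt_hPart157_T4`, `inner_dcE_hOp_eq_multiplier_T4` — read at the record's fine torus `Site (F.P K) 0` of a `T4Family` member.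

HONEST SCOPE.  Exact algebra (§1, §4), calculus (§2–§3) and bookkeeping (the slot); the three letters of the slot are HYPOTHESES — [B6] Prop. 2.7 (2.149) = [5]
(3.132) for `(QGQ*)⁻¹` in sup norms (the d = 4 port), Prop. 3's (55) for `D(A′)` (S2; UST `FlatChart47(Levels).size…` gives it from `C₂`, `B₀`), and the
column form of (73) for `𝔇(A′)ᵀ` (S2 ∕ port) —, trivially inhabited by zero maps (the letters quantify over the maps); the composed V₀-group
`(1 − H𝔇(A′))ᵀ(δ∕δA)V₀(A′ − HD(A′))` needs in addition the column letter of `H` ((46)ᵀ) and is NOT here; which `D : Domains` realises Sect. F's collared cube at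
the record is S3's.  Nothing of [15]'s analysis is asserted; `stub_prop8StepCoP13` ∕ K0⁷ NOT closed; N07 NOT discharged; counts unmoved (28∕28 · 5∕27); one
finite 𝕋⁴ programme at fixed ε — R4 closes the conditional finite-𝕋⁴ rung `BalabanLadder.UV` only, never the summit; the YM mass gap (Clay) is NOT proved by
any of this; nothing continuum ∕ ℝ⁴ ∕ OS.  No `sorry`, no `def`, no `instance`, no `notation`.

References: [15] (45)–(49) p.285, (55) p.286, (73) p.289, (80) p.290, (87)–(89) p.291, Prop. 4 (97)–(98) pp.292–293, (128) p.297, (137) p.298, (157)–(158) p.302,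
(165)–(166) p.304; [B6] (2.19) p.226, (2.34)–(2.35) p.228, Prop. 2.7 (2.149) p.249; T. Bałaban, CMP **109** (1987) 249–301 [Balaban1987RG1] (0.1) p.251.
-/

set_option autoImplicit false

noncomputable section

open scoped InnerProductSpace RealInnerProductSpace

namespace Summit.QuantumFields.YangMills.Theorems.K0Stub1SectFHTermsMultiplierForm

open Literature.MathematicalPhysics.QuantumFieldTheory.Balaban1983to89
open Literature.MathematicalPhysics.QuantumFieldTheory.Balaban1983to89.T4Continuum (T4Family)
open Literature.MathematicalPhysics.QuantumFieldTheory.BalabanImbrieJaffe1984to88.BIJ85AxialPropagator411 (BondSpace)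
open B6SectADomainsV1 (Domains)
open B6SectAOperatorsV1 (BondIdx BondIdxSpace QE QsE aE dcE dsE RE inner_QsE_left inner_dcsE_left inner_aE_left)
open B6SectAVectorModelV1 (deltaAE GE EE inner_deltaAE_right)
open B6SectA (hOp)
open Summit.QuantumFields.YangMills.Theorems.FlatCubeOperators (QE_hOp deltaAE_hOp inner_EE_left)
open Summit.QuantumFields.YangMills.Theorems.FlatHCurlCurl (curlCurl_hOp)

/-! ## §1  (87) at the flat operators of a nested family: `⟪∂Y, ∂(HX)⟫ = ⟪QY, ((QGQ*)⁻¹ − a)X⟫`, and the `H`-part of (157) in multiplier form -/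

section StructuralIdentity

variable {P : Params} (D : Domains P) {c : ℝ} (hc : c ≠ 0) {w : BondIdx D → ℝ} (hw : ∀ i, 0 < w i)

/-- **[15] (87) AT THE FLAT MULTI-LEVEL OPERATORS OF ANY NESTED FAMILY**: `⟪∂Y, ∂(HX)⟫ = ⟪QY, (QGQ*)⁻¹X⟫ − ⟪QY, aX⟫` for EVERY fine field `Y` and every block
datum `X` — the adjoint of (137) `∂*∂(HX) = Q*((QGQ*)⁻¹X) − Q*(aX)` (UST `FlatHCurlCurl.curlCurl_hOp`); the Landau condition enters only through `R∂*H = 0`,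
so no gauge condition on `Y` is needed. [cite: Balaban1985Variational, (87) p.291, (137) p.298; Balaban1984PropagatorsII, (2.19) p.226, (2.35) p.228] -/
theorem inner_dcE_hOp_eq_multiplier (Y : BondSpace P) (X : BondIdxSpace D) :
    ⟪dcE c Y, dcE c (hOp (GE D hc hw) (QsE D) (EE D hc hw) X)⟫_ℝ = ⟪QE D Y, EE D hc hw X⟫_ℝ - ⟪QE D Y, aE D w X⟫_ℝ := by
  rw [real_inner_comm, ← inner_dcsE_left, curlCurl_hOp D hc hw X, inner_sub_left, inner_QsE_left, inner_QsE_left,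
    real_inner_comm (QE D Y) (EE D hc hw X), real_inner_comm (QE D Y) (aE D w X)]

/-- The `Δ_a`-reading of (87): `⟪Y, Δ_a(HX)⟫ = ⟪QY, (QGQ*)⁻¹X⟫` (`Δ_aH = Q*(QGQ*)⁻¹`, UST `FlatCubeOperators.deltaAE_hOp`).
[cite: Balaban1985Variational, (87) p.291, (129) p.297; Balaban1984PropagatorsII, (2.22) p.226, (2.35) p.228] -/
theorem inner_deltaAE_hOp_eq_multiplier (Y : BondSpace P) (X : BondIdxSpace D) :
    ⟪Y, deltaAE D c w (hOp (GE D hc hw) (QsE D) (EE D hc hw) X)⟫_ℝ = ⟪QE D Y, EE D hc hw X⟫_ℝ := by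
  rw [deltaAE_hOp, real_inner_comm, inner_QsE_left, real_inner_comm (QE D Y) (EE D hc hw X)]

/-- ★ **THE `H`-PART OF SECT. F's FUNCTIONAL (157) IN PRINT's (87)–(88) MULTIPLIER FORM, EXACTLY**: for every fine field `A′` and EVERY block datum `X`,
`½‖∂(A′ − HX)‖² = ½‖∂A′‖² + ½(⟪X, (QGQ*)⁻¹X⟫ − ⟪X, aX⟫) − (⟪QA′, (QGQ*)⁻¹X⟫ − ⟪QA′, aX⟫)`; at `X = D(A′)` of (49) the last two groups are the two
`H`-terms `−⟨A′, ∂*∂HD(A′)⟩ + ½⟨HD(A′), ∂*∂HD(A′)⟩` of (80)∕(157) (`J = 0`, `Δ_π = ∂*∂`), now a form in the block data `(D(A′), QA′)` with the multiplier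
`M = (QGQ*)⁻¹ − a` and NO `∂*∂`. [cite: Balaban1985Variational, (157) p.302, (80) p.290, (87) p.291, (45) p.285] -/
theorem normSq_dcE_chart_expand (A' : BondSpace P) (X : BondIdxSpace D) :
    ‖dcE c (A' - hOp (GE D hc hw) (QsE D) (EE D hc hw) X)‖ ^ 2 / 2 =
      ‖dcE c A'‖ ^ 2 / 2 + (⟪X, EE D hc hw X⟫_ℝ - ⟪X, aE D w X⟫_ℝ) / 2
        - (⟪QE D A', EE D hc hw X⟫_ℝ - ⟪QE D A', aE D w X⟫_ℝ) := by
  have h1 := inner_dcE_hOp_eq_multiplier D hc hw A' X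
  have h2 := inner_dcE_hOp_eq_multiplier D hc hw (hOp (GE D hc hw) (QsE D) (EE D hc hw) X) X
  rw [QE_hOp] at h2
  rw [map_sub, norm_sub_sq_real, ← real_inner_self_eq_norm_sq (dcE c (hOp (GE D hc hw) (QsE D) (EE D hc hw) X)), h1, h2]
  ring

/-- The `Δ_a`-reading of the same expansion: `½⟪A′ − HX, Δ_a(A′ − HX)⟫ = ½⟪A′, Δ_aA′⟫ + ½⟪X, (QGQ*)⁻¹X⟫ − ⟪QA′, (QGQ*)⁻¹X⟫` (multiplier `(QGQ*)⁻¹`; the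
reading a consumer working with `Δ_a = ∂*∂ + ∂R∂* + Q*aQ` as the quadratic form uses). [cite: Balaban1985Variational, (79)–(80) p.290, (129) p.297; Balaban1984PropagatorsII, (2.19) p.226] -/
theorem inner_deltaAE_chart_expand (A' : BondSpace P) (X : BondIdxSpace D) :
    ⟪A' - hOp (GE D hc hw) (QsE D) (EE D hc hw) X, deltaAE D c w (A' - hOp (GE D hc hw) (QsE D) (EE D hc hw) X)⟫_ℝ / 2 =
      ⟪A', deltaAE D c w A'⟫_ℝ / 2 + ⟪X, EE D hc hw X⟫_ℝ / 2 - ⟪QE D A', EE D hc hw X⟫_ℝ := by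
  have h1 := inner_deltaAE_hOp_eq_multiplier D hc hw A' X
  have h2 := inner_deltaAE_hOp_eq_multiplier D hc hw (hOp (GE D hc hw) (QsE D) (EE D hc hw) X) X
  rw [QE_hOp] at h2
  have h3 : ⟪hOp (GE D hc hw) (QsE D) (EE D hc hw) X, deltaAE D c w A'⟫_ℝ = ⟪QE D A', EE D hc hw X⟫_ℝ := by
    rw [← B6SectAVectorModelV1.inner_deltaAE_left, real_inner_comm, h1]
  rw [map_sub, inner_sub_left, inner_sub_right, inner_sub_right, h1, h2, h3]
  ring

end StructuralIdentity

/-! ## §2  (88) on abstract carriers: the derivative and the gradient of the multiplier form (any real inner-product spaces), and its pointwise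
(98)-slot from letters (any `ℓ²`-product carriers — `EuclideanSpace ℝ ι` for the scalar model, `PiLp 2 (fun _ => 𝔰𝔲(N))` for S1's `TangentBondSU`) -/

section MultiplierForm

variable {E F : Type*} [NormedAddCommGroup E] [InnerProductSpace ℝ E] [NormedAddCommGroup F] [InnerProductSpace ℝ F]
variable (Q : E →L[ℝ] F) (M : F →L[ℝ] F) (Dm : E → F)

/-- ★ **(88), THE DERIVATIVE OF THE MULTIPLIER FORM**: for a continuous linear `Q` (the multi-level average), a self-adjoint `M` (print's
`(QGQ*)⁻¹ − a`) and a map `D` with Fréchet derivative `𝔇` at `A′` (print's `D(A′)` of (49), `𝔇(A′)` of (63)), the function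
`A ↦ ½⟪D A, M D A⟫ − ⟪QA, M D A⟫` has derivative `δ ↦ ⟪M(D A′ − QA′), 𝔇δ⟫ − ⟪M D A′, Qδ⟫` at `A′` — print's four terms of (88), with no derivative of
`A′` in them.  Any real inner-product spaces `E` (fine fields), `F` (block data). [cite: Balaban1985Variational, (88) p.291, (63) p.287] -/
theorem hasFDerivAt_multiplierForm (hM : ∀ a b, ⟪M a, b⟫_ℝ = ⟪a, M b⟫_ℝ) {A' : E} {𝔇 : E →L[ℝ] F} (hD : HasFDerivAt Dm 𝔇 A') :
    HasFDerivAt (fun A => 2⁻¹ * ⟪Dm A, M (Dm A)⟫_ℝ - ⟪Q A, M (Dm A)⟫_ℝ)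
      ((innerSL ℝ (M (Dm A' - Q A'))).comp 𝔇 - (innerSL ℝ (M (Dm A'))).comp Q) A' := by
  have hMD : HasFDerivAt (fun A => M (Dm A)) (M.comp 𝔇) A' := M.hasFDerivAt.comp A' hD
  have h := ((hD.inner ℝ hMD).const_mul (2⁻¹ : ℝ)).sub (Q.hasFDerivAt.inner ℝ hMD)
  refine h.congr_fderiv ?_
  ext δ
  have e1 : ⟪Dm A', M (𝔇 δ)⟫_ℝ = ⟪M (Dm A'), 𝔇 δ⟫_ℝ := (hM _ _).symm
  have e2 : ⟪𝔇 δ, M (Dm A')⟫_ℝ = ⟪M (Dm A'), 𝔇 δ⟫_ℝ := real_inner_comm _ _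
  have e3 : ⟪Q A', M (𝔇 δ)⟫_ℝ = ⟪M (Q A'), 𝔇 δ⟫_ℝ := (hM _ _).symm
  have e4 : ⟪Q δ, M (Dm A')⟫_ℝ = ⟪M (Dm A'), Q δ⟫_ℝ := real_inner_comm _ _
  simp only [sub_apply, smul_apply, ContinuousLinearMap.comp_apply,
    ContinuousLinearMap.prod_apply, fderivInnerCLM_apply, innerSL_apply_apply, smul_eq_mul, map_sub]
  rw [e1, e2, e3, e4]
  ring

/-- ★ **THE RIESZ VECTOR OF (88)**: under the same hypotheses (and completeness, automatic in finite dimension) the multiplier form has the GRADIENT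
`W_H(A′) = 𝔇†(M(D A′ − QA′)) − Q†(M D A′)` at `A′` (`†` the adjoint: print's `𝔇*(A′)`, `Q*`) — a vector of the fine carrier, the currency of the critical
equation (128) `⟪δ, Δ_aA′ + W A′⟫ = 0`. [cite: Balaban1985Variational, (88) p.291, (128) p.297] -/
theorem hasGradientAt_multiplierForm [CompleteSpace E] [CompleteSpace F] (hM : ∀ a b, ⟪M a, b⟫_ℝ = ⟪a, M b⟫_ℝ) {A' : E} {𝔇 : E →L[ℝ] F}
    (hD : HasFDerivAt Dm 𝔇 A') :
    HasGradientAt (fun A => 2⁻¹ * ⟪Dm A, M (Dm A)⟫_ℝ - ⟪Q A, M (Dm A)⟫_ℝ)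
      (ContinuousLinearMap.adjoint 𝔇 (M (Dm A' - Q A')) - ContinuousLinearMap.adjoint Q (M (Dm A'))) A' := by
  rw [hasGradientAt_iff_hasFDerivAt]
  refine (hasFDerivAt_multiplierForm Q M Dm hM hD).congr_fderiv ?_
  ext δ
  simp only [sub_apply, ContinuousLinearMap.comp_apply, innerSL_apply_apply,
    InnerProductSpace.toDual_apply_apply, inner_sub_left, ContinuousLinearMap.adjoint_inner_left]

end MultiplierForm

section Slot

variable {ι β V V' : Type*} [Fintype ι] [Fintype β]
  [NormedAddCommGroup V] [InnerProductSpace ℝ V] [CompleteSpace V] [NormedAddCommGroup V'] [InnerProductSpace ℝ V'] [CompleteSpace V']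
variable (Q : PiLp 2 (fun _ : ι => V) →L[ℝ] PiLp 2 (fun _ : β => V')) (M : PiLp 2 (fun _ : β => V') →L[ℝ] PiLp 2 (fun _ : β => V'))
  (Dm : PiLp 2 (fun _ : ι => V) → PiLp 2 (fun _ : β => V'))

/-- ★ **THE POINTWISE (98)-SLOT OF THE `H`-GROUPS FROM THE THREE PRINTED LETTERS** (p. 291 «Applying the inequalities (3.132) from [5], (55), (73) … we can
estimate this functional derivative by O(1)ε₃²(Lʲη)⁻³ on Ω_j»), in the route `UnitScaleTilt`'s pointwise weighted currency, on `ℓ²`-product carriers of fine fields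
(index `ι`, fibre `V`: `ℝ` for the scalar model, `𝔰𝔲(N)` for S1's `TangentBondSU`) and block data (index `β`, fibre `V′`): block weights `wB` (sizes of `D A′`, `QA′`) and
`wB′` (outputs of `M`), fine weight `w₃` (the (−3) size), `wB, w₃ ≥ 0`; LETTERS — (3.132): `M` maps size `s` to size `O₁s`; the adjoint average `Q†` maps size `s` to
size `q₀s`; (73)ᵀ: `𝔇(A′)†` maps size `s` to size `θs` (print: `θ = O(1)C₃·|A′|`); (55): `D A′` has size `C_D r²`; the average: `QA′` has size `q r` —; THEN
`w₃(b)·‖W_H(A′)(b)‖ ≤ θ·O₁·(C_D r² + q r) + q₀·O₁·C_D r²` at every fine bond.  With `θ = θ₀r` and `r ≤ a₃` this is `≤ (θ₀O₁(C_D a₃ + q) + q₀O₁C_D)·r²` — a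
constant in the letters only. [cite: Balaban1985Variational, (88) p.291, (97)–(98) p.293, (55) p.286, (73) p.289] -/
theorem gradMultiplierForm_slot98 (𝔇 : PiLp 2 (fun _ : ι => V) →L[ℝ] PiLp 2 (fun _ : β => V')) (A' : PiLp 2 (fun _ : ι => V))
    (wB wB' : β → ℝ) (w₃ : ι → ℝ) (hwB : ∀ i, 0 ≤ wB i) (hw₃ : ∀ b, 0 ≤ w₃ b) {O₁ q₀ θ CD q r : ℝ}
    (h3132 : ∀ (X : PiLp 2 (fun _ : β => V')) (s : ℝ), (∀ i, wB i * ‖X i‖ ≤ s) → ∀ i, wB' i * ‖M X i‖ ≤ O₁ * s)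
    (hQt : ∀ (X : PiLp 2 (fun _ : β => V')) (s : ℝ), (∀ i, wB' i * ‖X i‖ ≤ s) → ∀ b, w₃ b * ‖ContinuousLinearMap.adjoint Q X b‖ ≤ q₀ * s)
    (h73t : ∀ (X : PiLp 2 (fun _ : β => V')) (s : ℝ), (∀ i, wB' i * ‖X i‖ ≤ s) → ∀ b, w₃ b * ‖ContinuousLinearMap.adjoint 𝔇 X b‖ ≤ θ * s)
    (h55 : ∀ i, wB i * ‖Dm A' i‖ ≤ CD * r ^ 2) (hQ : ∀ i, wB i * ‖Q A' i‖ ≤ q * r) :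
    ∀ b, w₃ b * ‖(ContinuousLinearMap.adjoint 𝔇 (M (Dm A' - Q A')) - ContinuousLinearMap.adjoint Q (M (Dm A'))) b‖
      ≤ θ * (O₁ * (CD * r ^ 2 + q * r)) + q₀ * (O₁ * (CD * r ^ 2)) := by
  intro b
  -- sizes of the two block data
  have hX₁ : ∀ i, wB i * ‖(Dm A' - Q A') i‖ ≤ CD * r ^ 2 + q * r := fun i => by
    rw [PiLp.sub_apply]
    calc wB i * ‖Dm A' i - Q A' i‖ ≤ wB i * (‖Dm A' i‖ + ‖Q A' i‖) :=
          mul_le_mul_of_nonneg_left (norm_sub_le _ _) (hwB i)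
      _ = wB i * ‖Dm A' i‖ + wB i * ‖Q A' i‖ := mul_add _ _ _
      _ ≤ CD * r ^ 2 + q * r := add_le_add (h55 i) (hQ i)
  have hM₁ := h3132 (Dm A' - Q A') _ hX₁
  have hM₂ := h3132 (Dm A') _ h55
  have hT₁ := h73t (M (Dm A' - Q A')) _ hM₁ b
  have hT₂ := hQt (M (Dm A')) _ hM₂ b
  rw [PiLp.sub_apply]
  calc w₃ b * ‖ContinuousLinearMap.adjoint 𝔇 (M (Dm A' - Q A')) b - ContinuousLinearMap.adjoint Q (M (Dm A')) b‖
      ≤ w₃ b * (‖ContinuousLinearMap.adjoint 𝔇 (M (Dm A' - Q A')) b‖ + ‖ContinuousLinearMap.adjoint Q (M (Dm A')) b‖) :=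
        mul_le_mul_of_nonneg_left (norm_sub_le _ _) (hw₃ b)
    _ = w₃ b * ‖ContinuousLinearMap.adjoint 𝔇 (M (Dm A' - Q A')) b‖ + w₃ b * ‖ContinuousLinearMap.adjoint Q (M (Dm A')) b‖ :=
        mul_add _ _ _
    _ ≤ θ * (O₁ * (CD * r ^ 2 + q * r)) + q₀ * (O₁ * (CD * r ^ 2)) := add_le_add hT₁ hT₂

end Slot

/-! ## §3  At the flat operators of a nested family: the gradient of the `H`-part of (157) -/

section AtObjects

variable {P : Params} (D : Domains P) {c : ℝ} (hc : c ≠ 0) {w : BondIdx D → ℝ} (hw : ∀ i, 0 < w i)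

/-- ★★ **THE GRADIENT OF THE `H`-PART OF (157) AT THE RECORD's FLAT OPERATORS, WITHOUT `∂*∂`**: for ANY nested family `D`, ANY map `D(·)` from fine fields to
block data differentiable at `A′` with derivative `𝔇` (print's (49) and (63); UST `FlatChart47(Levels)` constructs it), and `Q`, `M` the continuous linear
readings of `QE D` and `EE D − aE D w` (displayed by their defining equations): the function `A ↦ ½‖∂(A − H D(A))‖² − ½‖∂A‖²` — the two `H`-terms of
Sect. F's `𝔊` — has GRADIENT `𝔇†(M(D A′ − QA′)) − Q†(M D A′)` at `A′` (print's (88) with `Δ_π + DRD*` replaced through (137)).  §1 + §2.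
[cite: Balaban1985Variational, (157) p.302, (87)–(88) p.291, (137) p.298] -/
theorem hasGradientAt_hPart157 (Qc : BondSpace P →L[ℝ] BondIdxSpace D) (hQc : ∀ A, Qc A = QE D A)
    (Mc : BondIdxSpace D →L[ℝ] BondIdxSpace D) (hMc : ∀ X, Mc X = EE D hc hw X - aE D w X)
    (Dm : BondSpace P → BondIdxSpace D) {A' : BondSpace P} {𝔇 : BondSpace P →L[ℝ] BondIdxSpace D} (hD : HasFDerivAt Dm 𝔇 A') :
    HasGradientAt (fun A => ‖dcE c (A - hOp (GE D hc hw) (QsE D) (EE D hc hw) (Dm A))‖ ^ 2 / 2 - ‖dcE c A‖ ^ 2 / 2)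
      (ContinuousLinearMap.adjoint 𝔇 (Mc (Dm A' - Qc A')) - ContinuousLinearMap.adjoint Qc (Mc (Dm A'))) A' := by
  have hM : ∀ a b, ⟪Mc a, b⟫_ℝ = ⟪a, Mc b⟫_ℝ := fun a b => by
    rw [hMc, hMc, inner_sub_left, inner_sub_right, inner_EE_left, inner_aE_left]
  have e : (fun A => ‖dcE c (A - hOp (GE D hc hw) (QsE D) (EE D hc hw) (Dm A))‖ ^ 2 / 2 - ‖dcE c A‖ ^ 2 / 2) =
      fun A => 2⁻¹ * ⟪Dm A, Mc (Dm A)⟫_ℝ - ⟪Qc A, Mc (Dm A)⟫_ℝ := by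
    funext A
    rw [normSq_dcE_chart_expand D hc hw A (Dm A), hQc, hMc, inner_sub_right, inner_sub_right]
    ring
  rw [e]
  exact hasGradientAt_multiplierForm Qc Mc Dm hM hD

/-- **THE (98)-SLOT OF THE `H`-GROUPS AT THE RECORD's FLAT OPERATORS** — §2's `gradMultiplierForm_slot98` read at `Q = QE D`, `M = EE D − aE D w`: the three printed
letters ([B6] Prop. 2.7 (2.149) = [5] (3.132) for `(QGQ*)⁻¹ − a` in weighted sup norms; the column form of (73) for `𝔇(A′)†`; (55) for `D(A′)`) and the two
structural ones (`Q†` local-bounded; the average does not increase the size) give the pointwise bound of the gradient vector of `hasGradientAt_hPart157`, with a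
constant in the letters only — no `‖∂*∂‖` (sizes written with `‖·‖ = |·|` on `ℝ`, `Real.norm_eq_abs`). [cite: Balaban1985Variational, (88) p.291, (98) p.293; Balaban1984PropagatorsII, Prop. 2.7 (2.149) p.249] -/
theorem hPart157_slot98 (Qc : BondSpace P →L[ℝ] BondIdxSpace D) (Mc : BondIdxSpace D →L[ℝ] BondIdxSpace D)
    (Dm : BondSpace P → BondIdxSpace D) (𝔇 : BondSpace P →L[ℝ] BondIdxSpace D) (A' : BondSpace P)
    (wB wB' : BondIdx D → ℝ) (w₃ : PBond P 0 → ℝ) (hwB : ∀ i, 0 ≤ wB i) (hw₃ : ∀ b, 0 ≤ w₃ b) {O₁ q₀ θ CD q r : ℝ}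
    (h3132 : ∀ (X : BondIdxSpace D) (s : ℝ), (∀ i, wB i * ‖X i‖ ≤ s) → ∀ i, wB' i * ‖Mc X i‖ ≤ O₁ * s)
    (hQt : ∀ (X : BondIdxSpace D) (s : ℝ), (∀ i, wB' i * ‖X i‖ ≤ s) → ∀ b, w₃ b * ‖ContinuousLinearMap.adjoint Qc X b‖ ≤ q₀ * s)
    (h73t : ∀ (X : BondIdxSpace D) (s : ℝ), (∀ i, wB' i * ‖X i‖ ≤ s) → ∀ b, w₃ b * ‖ContinuousLinearMap.adjoint 𝔇 X b‖ ≤ θ * s)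
    (h55 : ∀ i, wB i * ‖Dm A' i‖ ≤ CD * r ^ 2) (hQ : ∀ i, wB i * ‖Qc A' i‖ ≤ q * r) :
    ∀ b, w₃ b * ‖(ContinuousLinearMap.adjoint 𝔇 (Mc (Dm A' - Qc A')) - ContinuousLinearMap.adjoint Qc (Mc (Dm A'))) b‖
      ≤ θ * (O₁ * (CD * r ^ 2 + q * r)) + q₀ * (O₁ * (CD * r ^ 2)) :=
  gradMultiplierForm_slot98 Qc Mc Dm 𝔇 A' wB wB' w₃ hwB hw₃ h3132 hQt h73t h55 hQ

end AtObjects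

/-! ## §4  The junction one-liner: on `ker Q` and in the Landau gauge the forms of `Δ_a` and of (157) have the same first variation -/

section Junction

variable {P : Params} (D : Domains P) (c : ℝ) (w : BondIdx D → ℝ)

/-- **`Qδ = 0 ∧ R∂*A′ = 0 ⇒ ⟪δ, Δ_aA′⟫ = ⟪∂δ, ∂A′⟫`** — for tangent directions (83)∕(100) and a configuration in the gauge (153) the `∂R∂*`- and `Q*aQ`-parts of
`Δ_a = ∂*∂ + ∂R∂* + Q*aQ` do not contribute to the pairing, so k0-s1-w1's (128) `⟪δ, Δ_aA′ + W A′⟫ = 0` may be fed with the gradient of (157)'s `H`-part (§3)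
plus the V₀-group. [cite: Balaban1985Variational, (83) p.290, (100) p.293, (128) p.297, (153) p.301; Balaban1984PropagatorsII, (2.19) p.226] -/
theorem inner_deltaAE_eq_inner_dcE_of_ker_of_landau {δ A' : BondSpace P} (hδ : QE D δ = 0) (hA' : RE D c (dsE c A') = 0) :
    ⟪δ, deltaAE D c w A'⟫_ℝ = ⟪dcE c δ, dcE c A'⟫_ℝ := by
  rw [inner_deltaAE_right, hA', hδ, inner_zero_right, inner_zero_left, add_zero, add_zero]

end Junction

/-! ## §5  At the record's fine torus `Site (F.P K) 0` -/

section Record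

variable (F : T4Family) (K : ℕ) (D : Domains (F.P K)) {c : ℝ} (hc : c ≠ 0) {w : BondIdx D → ℝ} (hw : ∀ i, 0 < w i)

/-- (87) at the record's fine torus (any nested family there — the cube sequence (144) at the record once S3 names it). [cite: Balaban1985Variational, (87) p.291, (157) p.302; Balaban1987RG1, (0.1) p.251] -/
theorem inner_dcE_hOp_eq_multiplier_T4 (Y : BondSpace (F.P K)) (X : BondIdxSpace D) :
    ⟪dcE c Y, dcE c (hOp (GE D hc hw) (QsE D) (EE D hc hw) X)⟫_ℝ = ⟪QE D Y, EE D hc hw X⟫_ℝ - ⟪QE D Y, aE D w X⟫_ℝ :=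
  inner_dcE_hOp_eq_multiplier D hc hw Y X

/-- ★★ at the record: the gradient of the `H`-part of (157) at the record's flat operators, without `∂*∂` (`hasGradientAt_hPart157` at `P := F.P K`).
[cite: Balaban1985Variational, (157)–(158) p.302, (88) p.291; Balaban1987RG1, (0.1) p.251] -/
theorem hasGradientAt_hPart157_T4 (Qc : BondSpace (F.P K) →L[ℝ] BondIdxSpace D) (hQc : ∀ A, Qc A = QE D A)
    (Mc : BondIdxSpace D →L[ℝ] BondIdxSpace D) (hMc : ∀ X, Mc X = EE D hc hw X - aE D w X)
    (Dm : BondSpace (F.P K) → BondIdxSpace D) {A' : BondSpace (F.P K)} {𝔇 : BondSpace (F.P K) →L[ℝ] BondIdxSpace D}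
    (hD : HasFDerivAt Dm 𝔇 A') :
    HasGradientAt (fun A => ‖dcE c (A - hOp (GE D hc hw) (QsE D) (EE D hc hw) (Dm A))‖ ^ 2 / 2 - ‖dcE c A‖ ^ 2 / 2)
      (ContinuousLinearMap.adjoint 𝔇 (Mc (Dm A' - Qc A')) - ContinuousLinearMap.adjoint Qc (Mc (Dm A'))) A' :=
  hasGradientAt_hPart157 D hc hw Qc hQc Mc hMc Dm hD

end Record

end Summit.QuantumFields.YangMills.Theorems.K0Stub1SectFHTermsMultiplierForm

end
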